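import Summits.Ventures.HSemireg.WedgeHankelSubstitutionMoments

/-!
# Venture HSemireg — THE GENERAL LINEAR SUBSTITUTION (7): A SINGULAR SUBSTITUTION HAS RANK-ONE MOMENT MATRICES — `sbSeq g n q = c(q)·(β/α)^•` on the window, `S_c(g)` is an outer
# product, and every catalecticant of the moved class has rank `≤ 1` (the matrix form of H5's «singular substitutions evaluate the class»)

HONEST FRAMING. Part of the Lean index of the computation cell `pub-hsemireg` (seat p10 gen 18, Sunday typer «UNIFORM-IN-n»).
LINEAR ALGEBRA of Hankel matrices + th-7's sequence vocabulary ONLY: no variety, no cohomology theory, no sheaf, no Ext group, no semiregularity map; nothing here says that HC / HC_CM / HC_AV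
holds; no Literature fact is declared or used.  Custodian versions as in `WedgeHankelSiegelIdeal` (1/3) and `WedgeHankelFrameChange`; the dictionary (`Sym^c` of a rank-one map has rank one;
a degenerate frame sees one moment) is QUOTED, never asserted.

WHAT IS IN THE TREE.  H1b `sbSeq_comp_apply` (the window action), H1 `sbSeq_shear` / `expMul_spike_zero`, H5 `sbSeq_apply_zero` / `sbSeq_lower_zero_succ` / `Sb_w_of_det_eq_zero` (class side), H7
`sbMat` / `hankel1_sbSeq_eq_mul` / `rank_hankel1_sbSeq_le`.  THIS FILE (namespace `Summit.Ventures.HSemireg.Wedge.HankelFrameChange` continued):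
* §157 `expMul_congr_le` (E5's transform reads `q_0..q_j`); **`sbSeq_of_det_eq_zero`**: for `α ≠ 0`, `αδ = βγ` and `j ≤ m`, `sbSeq α β γ δ m q j = expMul α (scaleSeq γ q) m · (β/α)^j` — the
  SEQUENCE form of H5's evaluation (the `LU` factorization with `U`'s diagonal entry `0`, on the window).
* §158 `expMul_scaleSeq_spike` (`expMul α (scaleSeq γ δ_l) c = C(c,l) α^{c−l} γ^l`); **`sbMat_of_det_eq_zero`: `S_c(g) = vecMulVec ((β/α)^•) (l ↦ C(c,l) α^{c−l} γ^l)`** — an OUTER PRODUCT,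
  so **`rank_sbMat_le_one`**; and **`rank_hankel1_sbSeq_le_one`: `rank H_k(sbSeq g n q) ≤ 1`** for every `k ≤ n` and every singular `g` with `α ≠ 0` (H7's `H_k(g·q) = S_k H_k S_{n−k}ᵀ`).
NOT typed here: `α = 0` (then `βγ = 0`; the swap `Ψs` reduces it to the above or to `x ↦ 0`, H5 `Sb_w_of_alpha_beta_zero`); `det S_c(g) = det(g)^{c(c+1)/2}`; anything class- or Ext-side.
New names only.
-/

open Module
open scoped Matrix

namespace Summit.Ventures.HSemireg.Wedge.HankelFrameChange

open Summit.Ventures.HSemireg.Wedge Summit.Ventures.HSemireg.Wedge.Hankel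

variable (K : Type*) [Field K]

/-! ## §157. The moments of a singular substitution -/

/-- E5's binomial transform at `j` reads only `q_0, …, q_j`. -/
lemma expMul_congr_le (lam : K) {q q' : ℕ → K} {j : ℕ} (h : ∀ i ≤ j, q i = q' i) : expMul K lam q j = expMul K lam q' j := by
  rw [expMul_eq_sum, expMul_eq_sum]
  exact Finset.sum_congr rfl fun i hi => by rw [h i (Nat.lt_succ_iff.mp (Finset.mem_range.mp hi))]

/-- **THE MOMENTS OF A SINGULAR SUBSTITUTION: `sbSeq α β γ δ m q j = expMul α (scaleSeq γ q) m · (β/α)^j`** for `α ≠ 0`, `αδ = βγ`, `j ≤ m` — every moved class is `c(q)·`(the pure class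
of the image letter), on the window (H5 `Sb_w_of_det_eq_zero`, sequence side: `g = L·U` with `L = (α,0,γ,0)`, `U = (1, β/α, 0, 1)` and H1b's window action). -/
theorem sbSeq_of_det_eq_zero {α : K} (hα : α ≠ 0) {β γ δ : K} (hdet : α * δ - β * γ = 0) (m : ℕ) (q : ℕ → K) {j : ℕ} (hj : j ≤ m) :
    sbSeq K α β γ δ m q j = expMul K α (scaleSeq K γ q) m * (β / α) ^ j := by
  have e1 : α * 1 + 0 * 0 = α := by ring
  have e2 : α * (β / α) + 0 * 1 = β := by rw [zero_mul, add_zero, mul_div_cancel₀ β hα]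
  have e3 : γ * 1 + (0 : K) * 0 = γ := by ring
  have e4 : γ * (β / α) + 0 * 1 = δ := by
    rw [zero_mul, add_zero]
    field_simp
    linear_combination -hdet
  have h := sbSeq_comp_apply K α 0 γ 0 1 (β / α) 0 1 q (n := m) hj
  rw [e1, e2, e3, e4] at h
  rw [h, sbSeq_shear K (β / α) m _ hj]
  -- the lower factor leaves only the 0-th moment: `c·δ_0` on the window
  have hw : ∀ i ≤ j, sbSeq K α 0 γ 0 m q i = if i = 0 then expMul K α (scaleSeq K γ q) m else 0 := by
    intro i _
    rcases i with _ | i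
    · rw [if_pos rfl, sbSeq_apply_zero]
    · rw [if_neg (Nat.succ_ne_zero i), sbSeq_lower_zero_succ]
  rw [expMul_congr_le K (β / α) (q' := fun i => if i = 0 then expMul K α (scaleSeq K γ q) m else 0) hw, expMul_spike_zero]

/-! ## §158. The moment matrices of a singular substitution are outer products -/

/-- the `0`-th moment of a spike: `expMul α (scaleSeq γ δ_l) c = C(c,l) α^{c−l} γ^l`. -/
lemma expMul_scaleSeq_spike (α γ : K) (c l : ℕ) :
    expMul K α (scaleSeq K γ fun i => if i = l then (1 : K) else 0) c = (c.choose l : K) * α ^ (c - l) * γ ^ l := by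
  rw [expMul_eq_sum]
  by_cases hl : l ≤ c
  · rw [Finset.sum_eq_single l]
    · simp only [scaleSeq, if_true, mul_one]
    · intro i _ hi; simp only [scaleSeq]; rw [if_neg hi, mul_zero, mul_zero]
    · intro h; exact absurd (Finset.mem_range.mpr (by omega)) h
  · rw [Nat.choose_eq_zero_of_lt (by omega), Nat.cast_zero, zero_mul, zero_mul]
    refine Finset.sum_eq_zero fun i hi => ?_
    have hil : i ≠ l := by have := Finset.mem_range.mp hi; omega
    simp only [scaleSeq]; rw [if_neg hil, mul_zero, mul_zero]

/-- **`S_c(g)` OF A SINGULAR SUBSTITUTION IS AN OUTER PRODUCT: `sbMat α β γ δ c (c+1) = vecMulVec ((β/α)^a)_a (C(c,l) α^{c−l} γ^l)_l`** (`α ≠ 0`, `αδ = βγ`). -/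
theorem sbMat_of_det_eq_zero {α : K} (hα : α ≠ 0) {β γ δ : K} (hdet : α * δ - β * γ = 0) (c : ℕ) :
    sbMat K α β γ δ c (c + 1) = Matrix.vecMulVec (fun a : Fin (c + 1) => (β / α) ^ (a : ℕ)) (fun l : Fin (c + 1) => ((c.choose (l : ℕ) : K) * α ^ (c - (l : ℕ)) * γ ^ (l : ℕ))) := by
  ext a l
  rw [sbMat_apply, Matrix.vecMulVec_apply, sbSeq_of_det_eq_zero K hα hdet c _ (show (a : ℕ) ≤ c by have := a.2; omega), expMul_scaleSeq_spike, mul_comm]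

/-- **hence `rank S_c(g) ≤ 1`** for a singular substitution with `α ≠ 0`. -/
theorem rank_sbMat_le_one {α : K} (hα : α ≠ 0) {β γ δ : K} (hdet : α * δ - β * γ = 0) (c : ℕ) : (sbMat K α β γ δ c (c + 1)).rank ≤ 1 := by
  rw [sbMat_of_det_eq_zero K hα hdet c]
  exact Matrix.rank_vecMulVec_le _ _

/-- **EVERY CATALECTICANT OF A CLASS MOVED BY A SINGULAR SUBSTITUTION HAS RANK `≤ 1`**: `rank H_k(sbSeq α β γ δ n q) ≤ 1` for `k ≤ n`, `α ≠ 0`, `αδ = βγ` (H7's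
`H_k(g·q) = S_k · H_k(q) · S_{n−k}ᵀ` with `rank S_k ≤ 1`; class side: H5, the moved class is the pure class `c(q)·(β/α)^•`). -/
theorem rank_hankel1_sbSeq_le_one {n k : ℕ} (hk : k ≤ n) {α : K} (hα : α ≠ 0) {β γ δ : K} (hdet : α * δ - β * γ = 0) (q : ℕ → K) :
    (hankel1 K n k (sbSeq K α β γ δ n q)).rank ≤ 1 := by
  rw [hankel1_sbSeq_eq_mul K hk]
  exact ((Matrix.rank_mul_le_left _ _).trans (Matrix.rank_mul_le_left _ _)).trans (rank_sbMat_le_one K hα hdet k)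

end Summit.Ventures.HSemireg.Wedge.HankelFrameChange
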